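import Literature.Geometry.Symplectic.JHolomorphicChartLocalisation
import Literature.Geometry.Symplectic.JHolomorphicChartLocalization
import Literature.Geometry.Symplectic.JHolomorphicChartLocalizationConverse
import Literature.Geometry.Symplectic.JHolomorphicWeierstrassProofs
import Literature.Geometry.Symplectic.JSphereMeetsEmbeddedJSphere
import Summits.SmoothPoincare4.SmoothPoincare4.Theorems.SymplecticOrigamiGromovRecognitionRelEndHelperChartUniformOfCompactOpen

/-!
# The generalized Weierstraß theorem for `J`-holomorphic curves in a `4`-manifold
(registered helper `helper_jHolomorphicOfCompactOpenLimit` of line `cross-cap-laurent`, crux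
`GromovRecognitionRelEnd`, item stmt-SmoothPoincare4-11009; it is the analytic input of the birth
stub `stub_uniformLimitIsJSphere` of the split piece `GromovCompactnessSpheres`, child item
stmt-SmoothPoincare4-16777)

Setting: `X` a smooth `4`-manifold (charts in `EuclideanSpace ℝ (Fin 4)`), `JX` a smooth almost
complex structure on `X`, `us k : ℂ → X` smooth `JX`-holomorphic curves, `u : ℂ → X` continuous.

Claim (`helper_jHolomorphicOfCompactOpenLimit`): if `us k → u` in the compact-open topology (stated
in raw form: for every compact `K ⊆ ℂ` and open `O ⊇ u(K)`, eventually `us k` maps `K` into `O`),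
then `u` is smooth and `JX`-holomorphic.  This is C. Hummel, *Gromov's compactness theorem for
pseudo-holomorphic curves* (1997), Ch. III Prop. 3.1 ("a `C⁰`-convergent sequence of
`J`-holomorphic maps converges in `C^∞` and its limit is `J`-holomorphic") for curves `ℂ → X`; the
analysis is the tree's PROVED flat theorem `Literature.Geometry.Symplectic.JHolomorphicWeierstrassR4_holds`
(`JHolomorphicWeierstrassProofs.lean`), and this file is the chart bookkeeping around it:

* `UniformLimit.contMDiffAt_of_chartUniform` — the pointwise statement: if the chart expressions
  `extChartAt x₀ ∘ us k` converge uniformly to `extChartAt x₀ ∘ u` on a closed disc about `z₀`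
  mapped by `u` into the chart domain of `x₀ = u z₀`, then `u` is `C^∞` at `z₀` and
  `du(z₀)(iζ) = JX (du(z₀) ζ)`.  Proof: the coordinate almost complex structure `Jc` of the chart
  (`exists_coordinateACS`) is globalised by a cut-off (`ChartLocalisation.exists_contDiff_sq_neg_eqOn_ball`)
  to a smooth `Jg` on `ℝ⁴` with `Jg² = -1`, equal to `Jc` on a ball about `extChartAt x₀ x₀`; on
  a small disc about `z₀` the chart expressions of the `us k` eventually take values in that ball,
  are `C^∞` (`ChartLocalisation.contDiffAt_chart`) and flat `Jg`-holomorphic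
  (`jHolomorphic_fderiv_chart`), so the flat Weierstraß theorem makes the limit chart expression
  `C^∞` and flat `Jg`-holomorphic there; smoothness and `J`-holomorphy transfer back to `u`
  (`contMDiffAt_of_extChartAt_comp`, `jHolomorphic_of_fderiv_chart`).
* `helper_jHolomorphicOfCompactOpenLimit` — the registered signature, verbatim: at each `z₀`
  choose a closed disc mapped by `u` into the chart domain of `u z₀`, read the compact-open
  convergence uniformly in that chart (the landed registered helper
  `helper_chartUniformOfCompactOpen`, `…HelperChartUniformOfCompactOpen.lean`), and apply the
  pointwise statement.

References: C. Hummel, *Gromov's Compactness Theorem for Pseudo-holomorphic Curves*, Progress in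
Math. 151 (1997), Ch. III Prop. 3.1; D. McDuff, D. Salamon, *J-holomorphic curves and symplectic
topology*, 2nd ed. (2012), Thm. B.4.2.  No new definitions, notation or instances.
-/

noncomputable section

open scoped Manifold ContDiff Topology
open Set Function Filter Metric Literature.Geometry.Symplectic

-- the prescribed namespace `Summit.<P>.<Sub>.…` duplicates `SmoothPoincare4` (P = Sub)
set_option linter.dupNamespace false

namespace Summit.SmoothPoincare4.SmoothPoincare4.Theorems.GromovRecognitionRelEnd.CrossCapLaurent

namespace UniformLimit

variable {X : Type} [TopologicalSpace X] [ChartedSpace (EuclideanSpace ℝ (Fin 4)) X]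
  [IsManifold (𝓡 4) ∞ X]

/-- **A global smooth almost complex structure on `ℝ⁴` reading `JX` near `x₀` through the chart.**
There are a `C^∞` field `Jg` on `ℝ⁴` with `Jg² = -1` everywhere and `δ > 0` such that
`Jg (extChartAt x₀ x)` is the frame expression of `JX x` for every `x` in the chart domain of `x₀`
with `extChartAt x₀ x ∈ ball (extChartAt x₀ x₀) δ` (`exists_coordinateACS` globalised by
`ChartLocalisation.exists_contDiff_sq_neg_eqOn_ball`). [folklore] -/
theorem exists_globalACS (JX : AlmostComplexStructure (𝓡 4) ∞ X) (x₀ : X) :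
    ∃ (Jg : (EuclideanSpace ℝ (Fin 4)) → (EuclideanSpace ℝ (Fin 4)) →L[ℝ] (EuclideanSpace ℝ (Fin 4))) (δ : ℝ), 0 < δ ∧ ContDiff ℝ ∞ Jg ∧ (∀ y v, Jg y (Jg y v) = -v) ∧
      ∀ x ∈ (chartAt (EuclideanSpace ℝ (Fin 4)) x₀).source, extChartAt (𝓡 4) x₀ x ∈ ball (extChartAt (𝓡 4) x₀ x₀) δ →
        Jg (extChartAt (𝓡 4) x₀ x) =
          inTangentCoordinates (𝓡 4) (𝓡 4) (id : X → X) id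
            (fun x => (JX x : TangentSpace (𝓡 4) x →L[ℝ] TangentSpace (𝓡 4) x)) x₀ x := by
  obtain ⟨Jc, hJc, hJc2, hJcE⟩ := exists_coordinateACS
    (fun x => (JX x : TangentSpace (𝓡 4) x →L[ℝ] TangentSpace (𝓡 4) x))
    (fun x v => JX.map_map x v) (fun x => JX.contMDiffAt_inTangentCoordinates x) x₀
  obtain ⟨Jg, hJg, hJg2, r, hr, -, hEq⟩ :=
    ChartLocalisation.exists_contDiff_sq_neg_eqOn_ball (isOpen_extChartAt_target (I := 𝓡 4) x₀)
      hJc hJc2 (mem_extChartAt_target (I := 𝓡 4) x₀)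
  refine ⟨Jg, r, hr, hJg, hJg2, fun x hx hxr => ?_⟩
  rw [hEq hxr]
  exact hJcE x hx

/-- Shifting the index of a uniformly convergent sequence: `F (n + k₀) → f` uniformly on `s`.
[folklore] -/
theorem tendstoUniformlyOn_add {α β : Type*} [UniformSpace β] {F : ℕ → α → β} {f : α → β}
    {s : Set α} (h : TendstoUniformlyOn F f atTop s) (k₀ : ℕ) :
    TendstoUniformlyOn (fun n => F (n + k₀)) f atTop s := fun U hU =>
  (tendsto_add_atTop_nat k₀).eventually (h U hU)

/-- **The generalized Weierstraß theorem at a point, chart form.** Let `us k : ℂ → X` be smooth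
`JX`-holomorphic curves and `u : ℂ → X` continuous; suppose `u` maps the closed disc
`closedBall z₀ r` (`0 < r`) into the chart domain of `x₀ = u z₀`, that eventually the `us k` do
too, and that the chart expressions `extChartAt x₀ ∘ us k` converge uniformly on that disc to
`extChartAt x₀ ∘ u`. Then `u` is `C^∞` at `z₀` and `du(z₀)(iζ) = JX (du(z₀) ζ)` for all `ζ`
(Hummel 1997, Ch. III Prop. 3.1, via the flat theorem `JHolomorphicWeierstrassR4_holds`).
[cite: Hummel1997, Ch. III Prop. 3.1] -/
theorem contMDiffAt_of_chartUniform (JX : AlmostComplexStructure (𝓡 4) ∞ X)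
    {us : ℕ → ℂ → X} {u : ℂ → X} (hus : ∀ k, ContMDiff 𝓘(ℝ, ℂ) (𝓡 4) ∞ (us k))
    (hJ : ∀ k, IsJHolomorphic (𝓡 4) (fun y => JX y) (us k)) (hu : Continuous u)
    {z₀ : ℂ} {r : ℝ} (hr : 0 < r)
    (hmaps : MapsTo u (closedBall z₀ r) (chartAt (EuclideanSpace ℝ (Fin 4)) (u z₀)).source)
    (hev : ∀ᶠ k in atTop, MapsTo (us k) (closedBall z₀ r) (chartAt (EuclideanSpace ℝ (Fin 4)) (u z₀)).source)
    (hunif : TendstoUniformlyOn (fun k z => extChartAt (𝓡 4) (u z₀) (us k z))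
      (fun z => extChartAt (𝓡 4) (u z₀) (u z)) atTop (closedBall z₀ r)) :
    ContMDiffAt 𝓘(ℝ, ℂ) (𝓡 4) ∞ u z₀ ∧
      ∀ ζ : ℂ, mfderiv 𝓘(ℝ, ℂ) (𝓡 4) u z₀ (Complex.I * ζ : ℂ) =
        JX (u z₀) (mfderiv 𝓘(ℝ, ℂ) (𝓡 4) u z₀ (ζ : ℂ)) := by
  set x₀ : X := u z₀ with hx₀
  set φ : X → (EuclideanSpace ℝ (Fin 4)) := fun x => extChartAt (𝓡 4) x₀ x with hφ
  -- the global coordinate almost complex structure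
  obtain ⟨Jg, δ, hδ, hJg, hJg2, hJgE⟩ := exists_globalACS JX x₀
  -- the chart expressions
  set g : ℂ → (EuclideanSpace ℝ (Fin 4)) := fun z => φ (u z) with hg
  set f : ℕ → ℂ → (EuclideanSpace ℝ (Fin 4)) := fun k z => φ (us k z) with hf
  have hg_cont : ContinuousOn g (closedBall z₀ r) := by
    have hφc : ContinuousOn φ (chartAt (EuclideanSpace ℝ (Fin 4)) x₀).source := by
      rw [hφ, ← extChartAt_source (𝓡 4)]
      exact continuousOn_extChartAt x₀
    exact hφc.comp hu.continuousOn hmaps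
  -- a smaller disc on which `g` stays in the `δ/2`-ball about `φ x₀`
  have hg0 : g z₀ = φ x₀ := rfl
  obtain ⟨r', hr', hr'r, hball⟩ : ∃ r' : ℝ, 0 < r' ∧ r' ≤ r ∧
      ∀ z ∈ ball z₀ r', g z ∈ ball (φ x₀) (δ / 2) := by
    have hcz : ContinuousAt g z₀ :=
      (hg_cont z₀ (mem_closedBall_self hr.le)).continuousAt (closedBall_mem_nhds z₀ hr)
    have hev' : ∀ᶠ z in 𝓝 z₀, g z ∈ ball (φ x₀) (δ / 2) :=
      hcz.preimage_mem_nhds (isOpen_ball.mem_nhds (by rw [hg0]; exact mem_ball_self (by positivity)))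
    obtain ⟨ρ, hρ, hρb⟩ := Metric.eventually_nhds_iff_ball.1 hev'
    exact ⟨min ρ r, lt_min hρ hr, min_le_right _ _,
      fun z hz => hρb z (ball_subset_ball (min_le_left _ _) hz)⟩
  set U : Set ℂ := ball z₀ r' with hU
  have hUsub : U ⊆ closedBall z₀ r := (ball_subset_ball hr'r).trans ball_subset_closedBall
  -- eventually the chart expressions of the `us k` stay in the `δ`-ball on `U`
  have hev2 : ∀ᶠ k in atTop, ∀ z ∈ U, f k z ∈ ball (φ x₀) δ := by
    filter_upwards [Metric.tendstoUniformlyOn_iff.1 hunif (δ / 2) (by positivity)] with k hk z hz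
    have h1 : dist (g z) (f k z) < δ / 2 := hk z (hUsub hz)
    have h2 : dist (g z) (φ x₀) < δ / 2 := hball z hz
    rw [mem_ball]
    calc dist (f k z) (φ x₀) ≤ dist (f k z) (g z) + dist (g z) (φ x₀) := dist_triangle _ _ _
      _ < δ / 2 + δ / 2 := by rw [dist_comm]; exact add_lt_add h1 h2
      _ = δ := by ring
  obtain ⟨k₀, hk₀⟩ := eventually_atTop.1 (hev.and hev2)
  -- the shifted sequence satisfies the hypotheses of the flat Weierstraß theorem on `U`
  have hsrc : ∀ n, ∀ z ∈ U, us (n + k₀) z ∈ (chartAt (EuclideanSpace ℝ (Fin 4)) x₀).source := fun n z hz =>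
    (hk₀ (n + k₀) (Nat.le_add_left _ _)).1 (hUsub hz)
  have hballf : ∀ n, ∀ z ∈ U, f (n + k₀) z ∈ ball (φ x₀) δ := fun n z hz =>
    (hk₀ (n + k₀) (Nat.le_add_left _ _)).2 z hz
  have hsmooth : ∀ n, ContDiffOn ℝ ∞ (f (n + k₀)) U := fun n z hz =>
    (ChartLocalisation.contDiffAt_chart ((hus (n + k₀)) z) (hsrc n z hz)).contDiffWithinAt
  have hhol : ∀ n, ∀ z ∈ U, ∀ ζ : ℂ,
      fderiv ℝ (f (n + k₀)) z (Complex.I * ζ) = Jg (f (n + k₀) z) (fderiv ℝ (f (n + k₀)) z ζ) := by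
    intro n z hz ζ
    have h1 := jHolomorphic_fderiv_chart
      (fun x => (JX x : TangentSpace (𝓡 4) x →L[ℝ] TangentSpace (𝓡 4) x))
      (x₀ := x₀) ((hus (n + k₀)) z) ((hJ (n + k₀)) z) (hsrc n z hz) ζ
    rw [hf]
    rw [h1, hJgE (us (n + k₀) z) (hsrc n z hz) (hballf n z hz)]
  have hlim : TendstoLocallyUniformlyOn (fun n => f (n + k₀)) g atTop U :=
    ((tendstoUniformlyOn_add hunif k₀).mono hUsub).tendstoLocallyUniformlyOn
  -- the flat Weierstraß theorem
  obtain ⟨hgU, hghol, -⟩ := JHolomorphicWeierstrassR4_holds Jg hJg hJg2 U isOpen_ball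
    (fun n => f (n + k₀)) g hsmooth hhol hlim
  -- transfer back to the manifold
  have hz₀U : z₀ ∈ U := mem_ball_self hr'
  have hz₀src : u z₀ ∈ (chartAt (EuclideanSpace ℝ (Fin 4)) x₀).source := mem_chart_source (EuclideanSpace ℝ (Fin 4)) x₀
  have hgz₀ : ContDiffAt ℝ ∞ g z₀ := hgU.contDiffAt (isOpen_ball.mem_nhds hz₀U)
  have hsm : ContMDiffAt 𝓘(ℝ, ℂ) (𝓡 4) ∞ u z₀ :=
    contMDiffAt_of_extChartAt_comp hu.continuousAt hz₀src hgz₀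
  refine ⟨hsm, fun ζ => ?_⟩
  refine jHolomorphic_of_fderiv_chart
    (fun x => (JX x : TangentSpace (𝓡 4) x →L[ℝ] TangentSpace (𝓡 4) x)) hsm (by simp) hz₀src
    (fun ζ' => ?_) ζ
  have h2 := hghol z₀ hz₀U ζ'
  have h3 : Jg (g z₀) = inTangentCoordinates (𝓡 4) (𝓡 4) (id : X → X) id
      (fun x => (JX x : TangentSpace (𝓡 4) x →L[ℝ] TangentSpace (𝓡 4) x)) x₀ (u z₀) :=
    hJgE (u z₀) hz₀src (by rw [← hx₀]; exact mem_ball_self hδ)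
  rw [h3] at h2
  exact h2

end UniformLimit

open UniformLimit in
/-- **Registered helper `helper_jHolomorphicOfCompactOpenLimit` (generalized Weierstraß theorem
for `J`-holomorphic curves in a `4`-manifold, Hummel 1997 Ch. III Prop. 3.1):** a compact-open
limit `u` of smooth `JX`-holomorphic curves `us k : ℂ → X` is smooth and `JX`-holomorphic.  At each
`z₀`, a closed disc about `z₀` mapped by the continuous `u` into the chart domain of `u z₀` is
chosen, the convergence is read uniformly in that chart (`helper_chartUniformOfCompactOpen`), and
`UniformLimit.contMDiffAt_of_chartUniform` applies. [cite: Hummel1997, Ch. III Prop. 3.1] -/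
theorem helper_jHolomorphicOfCompactOpenLimit : ∀ (X : Type) [TopologicalSpace X] [T2Space X] [SecondCountableTopology X] [ChartedSpace (EuclideanSpace ℝ (Fin 4)) X] [IsManifold (𝓡 4) ∞ X] (JX : Literature.Geometry.Symplectic.AlmostComplexStructure (𝓡 4) ∞ X) (us : ℕ → ℂ → X) (u : ℂ → X), (∀ k, ContMDiff 𝓘(ℝ, ℂ) (𝓡 4) ∞ (us k)) → (∀ k, Literature.Geometry.Symplectic.IsJHolomorphic (𝓡 4) (fun y => JX y) (us k)) → Continuous u → (∀ K : Set ℂ, IsCompact K → ∀ O : Set X, IsOpen O → Set.MapsTo u K O → ∀ᶠ k in Filter.atTop, Set.MapsTo (us k) K O) → ContMDiff 𝓘(ℝ, ℂ) (𝓡 4) ∞ u ∧ Literature.Geometry.Symplectic.IsJHolomorphic (𝓡 4) (fun y => JX y) u := by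
  intro X _ _ _ _ _ JX us u hus hJ hu hco
  -- the pointwise statement at every `z₀`
  have key : ∀ z₀ : ℂ, ContMDiffAt 𝓘(ℝ, ℂ) (𝓡 4) ∞ u z₀ ∧
      ∀ ζ : ℂ, mfderiv 𝓘(ℝ, ℂ) (𝓡 4) u z₀ (Complex.I * ζ : ℂ) =
        JX (u z₀) (mfderiv 𝓘(ℝ, ℂ) (𝓡 4) u z₀ (ζ : ℂ)) := by
    intro z₀
    -- a closed disc about `z₀` mapped into the chart domain of `u z₀`
    have hpre : u ⁻¹' (chartAt (EuclideanSpace ℝ (Fin 4)) (u z₀)).source ∈ 𝓝 z₀ :=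
      hu.continuousAt.preimage_mem_nhds
        ((chartAt (EuclideanSpace ℝ (Fin 4)) (u z₀)).open_source.mem_nhds
          (mem_chart_source _ (u z₀)))
    obtain ⟨r, hr, hrsub⟩ := Metric.nhds_basis_closedBall.mem_iff.1 hpre
    have hmaps : MapsTo u (closedBall z₀ r) (chartAt (EuclideanSpace ℝ (Fin 4)) (u z₀)).source :=
      fun z hz => hrsub hz
    obtain ⟨hunif, hev⟩ := helper_chartUniformOfCompactOpen X us u (u z₀) (closedBall z₀ r)
      (fun k => (hus k).continuous) hu (isCompact_closedBall z₀ r) hmaps hco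
    exact contMDiffAt_of_chartUniform JX hus hJ hu hr hmaps hev hunif
  exact ⟨fun z => (key z).1, fun z ζ => (key z).2 ζ⟩

end Summit.SmoothPoincare4.SmoothPoincare4.Theorems.GromovRecognitionRelEnd.CrossCapLaurent

end
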